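import Summits.CriticalPhenomena.PercolationContinuityZ3.Theorems.Transplant.SkelSign2ParamsAtQ
import HarnessLib

/-!
# D″ L7′ params, part 6c: THE BAND-WIDTH VALUES of `signChoice₂` shared by the three residues — per run axis `a` (`∥ := a`, `⊥ := oth a`): the landing
# half-width `qR' := widths a ℓ1∥ ⊥`, the clamped band widths `WbR ℓ = WbC ℓ := widths a (max ℓ ℓ₀∥) ⊥`, the short-run bound `WMR := widths a (e∥ + R′) ⊥`
# and the full-range bound `WMC := widths a ℓtop∥ ⊥`; with the AtQ-level facts about them: `root_std_at` (the seven inputs of p2's `rootBandOKR_std`),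
# `root_route_at` (the root band's route range `[e − R′, e + R′] ⊆ Sx ∩ Sy`), `widths_at` (`WbC ≤ WMC` on `[0, ℓtop]`, `widths ≤ WbC` on `[ℓ₀, ℓtop]`, `8·WMC ≤ r⊥`)

builds on p205010 (kernel theorem, internal audit signed; external expert review pending) — nothing in this file uses p205010.
Lane `prim-bschramm-*`, seat `prim-bschramm-stmt` (gen 9); helper file (`--supports stmt-CriticalPhenomena-4575`).  MODULE PLACEMENT (lead g5 ruling
2026-08-21T08:21:49Z (2)): these five defs and three facts were drafted in `SkelSign2ParamsRoot` ((R): `qR' WbR WMR root_std_at root_route_at`) and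
`SkelSign2ParamsCorr` ((C): `WbC WMC widths_at`); they are exactly what the (F) files `SkelSign2ParamsFaceVal/Face` need from (R)/(C), and their proofs are
AtQ-level, so they live here (imports `SkelSign2ParamsAtQ` only) and `Root`, `Corr`, `FaceVal` import this file — one gate round saved, no name or argument
order changed (namespace `PlanarSkeletonSign.Sgn₂`, arguments `κ Φ p O a`).
[cite: KozmaNitzan2024, §4 Lemma 11 (pp. 22–23: the band widths of the chained rectangles), Theorem 6 (pp. 27–30)]
-/

noncomputable section

open scoped Classical

namespace Summit.CriticalPhenomena.PercolationContinuityZ3.Theorems.Transplant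

namespace PlanarSkeletonSign

namespace Sgn₂

open Literature.Probability.Percolation Literature.Probability.LatticeModels SimpleGraph
open Literature.Probability.Percolation.KozmaNitzan.Cells (oth)
open SkelConc (Consts)
open Sgn (K a A L twenty_le_K one_le_a hundred_le_A K_le_A five_le_L sixteen_L_le_A δkit δI m₀ Mu ρz M T₀ Kd Rseed rs cU sB B kP NP Lcnt Rlev R' η reachK Sz L_hyps)

section Defs

variable (κ : Consts) {V : Type} [DecidableEq V] [Countable V] {G : SimpleGraph V} [G.LocallyFinite] (Φ : PlanarSkeletonSign G)
  (p : unitInterval) (O : Skelφ.StepI.Out V) (a : Fin 2)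

/-! ## §1 The values -/

/-- **The landing half-width** `qR' := widths a ℓ1∥ ⊥` (the side-half of the first-hop rectangle). [this work] -/
def qR' : ℕ := Skelφ.StepI.widths O.D.Gb O.D.Fb a (ℓ1 κ Φ p O a) (oth a)

/-- The band width function `WbR ℓ := widths a (max ℓ ℓ₀∥) ⊥` (clamped below at `ℓ₀ ≥ D.k`). [this work] -/
def WbR (ℓ : ℕ) : ℕ := Skelφ.StepI.widths O.D.Gb O.D.Fb a (max ℓ (ℓ₀ κ Φ p O a)) (oth a)

/-- The band width bound `WMR := widths a (e∥ + R′) ⊥` (every extent of the short-stride run is `≤ s₁ + R′ = e∥ + R′`). [this work] -/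
def WMR : ℕ := Skelφ.StepI.widths O.D.Gb O.D.Fb a (e κ Φ p O a + R' κ Φ p O) (oth a)

/-- **The clamped band width** of axis `a`: `WbC ℓ := widths a (max ℓ ℓ₀∥) ⊥` (clamped below at `ℓ₀ ≥ D.k`, p5 (A6)(iii)). [this work] -/
def WbC (ℓ : ℕ) : ℕ := Skelφ.StepI.widths O.D.Gb O.D.Fb a (max ℓ (ℓ₀ κ Φ p O a)) (oth a)

/-- **The band width bound** of axis `a`: `WMC := widths a ℓtop∥ ⊥` (every certified extent is `≤ ℓtop`). [this work] -/
def WMC : ℕ := Skelφ.StepI.widths O.D.Gb O.D.Fb a (ℓtop κ Φ p O a) (oth a)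

end Defs

section AtQ

variable {κ : Consts} {V : Type} [DecidableEq V] [Countable V] {G : SimpleGraph V} [G.LocallyFinite] {Φ : PlanarSkeletonSign G}
  {t : V} {p : unitInterval} {hC : Φ.CylSubcritical p} {O : Skelφ.StepI.Out V} {q : unitInterval}
  (hat : (choiceAt κ Φ t p hC).AtQ O q)
include hat

/-! ## §2 The facts at the running density -/

/-- **The seven facts of `rootBandOKR_std`** at `e := e∥`, `q' := qR'`, `WM := WMR`, `Wb := WbR`: `1 ≤ e`, `2R′ ≤ e`, `e + 2R′ + 2 ≤ 12 r∥`, `e ≤ 6 r∥`,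
`12 r∥ R′ ≤ e · r⊥`, `8 q′ ≤ r⊥`, `8 WM ≤ r⊥`, and `∀ ℓ ≤ e + R′, Wb ℓ ≤ WM`. [folklore] -/
theorem root_std_at (a : Fin 2) : 1 ≤ e κ Φ p O a ∧ 2 * R' κ Φ p O ≤ e κ Φ p O a ∧ e κ Φ p O a + 2 * R' κ Φ p O + 2 ≤ 12 * (cells κ Φ p O).r a ∧
    e κ Φ p O a ≤ 6 * (cells κ Φ p O).r a ∧ 12 * (cells κ Φ p O).r a * R' κ Φ p O ≤ e κ Φ p O a * (cells κ Φ p O).r (oth a) ∧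
    8 * qR' κ Φ p O a ≤ (cells κ Φ p O).r (oth a) ∧ 8 * WMR κ Φ p O a ≤ (cells κ Φ p O).r (oth a) ∧
    ∀ ℓ, ℓ ≤ e κ Φ p O a + R' κ Φ p O → WbR κ Φ p O a ℓ ≤ WMR κ Φ p O a := by
  have he := one_le_e_at hat a
  have hu := units_large_at hat a
  have huo := units_large_at hat (oth a)
  have hr := cells_r_at hat a
  have hro := cells_r_at hat (oth a)
  have hA := hundred_le_A κ
  have hb := extents_le_at hat a
  have hk1 : O.D.k ≤ ℓ1 κ Φ p O a := (Mu_succ_le_ℓ₀_at hat a).2.trans (hb.1.trans hb.2.1)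
  have hkE : O.D.k ≤ e κ Φ p O a + R' κ Φ p O := (n₀_le_e_at hat a).2.trans (Nat.le_add_right _ _)
  have hER : e κ Φ p O a + R' κ Φ p O ≤ ℓtop κ Φ p O a := by unfold ℓtop; nlinarith [five_le_L κ]
  have hw1 : 8 * qR' κ Φ p O a ≤ (cells κ Φ p O).r (oth a) := by
    unfold qR'; fin_cases a
    · simpa [oth] using spread_x_at hat hk1 hb.2.2.1
    · simpa [oth] using spread_y_at hat hk1 hb.2.2.1
  have hw2 : 8 * WMR κ Φ p O a ≤ (cells κ Φ p O).r (oth a) := by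
    unfold WMR; fin_cases a
    · simpa [oth] using spread_x_at hat hkE hER
    · simpa [oth] using spread_y_at hat hkE hER
  have h2R : 2 * R' κ Φ p O ≤ e κ Φ p O a := by have h := (strides_at hat a).2.2.2.2.2.2.1; unfold sS at h; exact h
  have h0k : O.D.k ≤ ℓ₀ κ Φ p O a := (Mu_succ_le_ℓ₀_at hat a).2
  refine ⟨he, h2R, ?_, ?_, ?_, hw1, hw2, fun ℓ hℓ => ?_⟩
  · rw [hr]; nlinarith
  · rw [hr]; nlinarith
  · rw [hr, hro]
    have h12 : 12 * R' κ Φ p O ≤ e κ Φ p O (oth a) := by nlinarith [huo.1]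
    calc 12 * (A κ * e κ Φ p O a) * R' κ Φ p O = (A κ * e κ Φ p O a) * (12 * R' κ Φ p O) := by ring
      _ ≤ (A κ * e κ Φ p O a) * e κ Φ p O (oth a) := Nat.mul_le_mul_left _ h12
      _ = e κ Φ p O a * (A κ * e κ Φ p O (oth a)) := by ring
  · unfold WbR WMR
    exact widths_oth_mono hat a (h0k.trans (le_max_right _ _)) (max_le hℓ (by have := hb.1; omega))

/-- **The root band's route rooms** (p2-g8 (ii)): `Smin ≤ e − R′`, `e + R′ ≤ ℓtop∥ ≤ Smax`, `Mu + 1 ≤ e − R′` (`hMz`), `D.k ≤ e − R′`, and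
`[e − R′, e + R′] ⊆ Sx ∩ Sy`; the depth room on that range is `hdepth_range_at`. [folklore] -/
theorem root_route_at (a : Fin 2) : Smin κ Φ p O ≤ e κ Φ p O a - R' κ Φ p O ∧ e κ Φ p O a + R' κ Φ p O ≤ ℓtop κ Φ p O a ∧
    ℓtop κ Φ p O a ≤ Smax κ Φ p O ∧ Mu O + 1 ≤ e κ Φ p O a - R' κ Φ p O ∧ O.D.k ≤ e κ Φ p O a - R' κ Φ p O ∧
    ∀ ℓ, e κ Φ p O a - R' κ Φ p O ≤ ℓ → ℓ ≤ e κ Φ p O a + R' κ Φ p O → ℓ ∈ Sx κ Φ p O ∧ ℓ ∈ Sy κ Φ p O := by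
  have hS := Smin_Smax_at hat a
  have h0 := Mu_succ_le_ℓ₀_at hat a
  have hER : e κ Φ p O a + R' κ Φ p O ≤ ℓtop κ Φ p O a := by
    have := units_large_at hat a; have := hundred_le_A κ; unfold ℓtop; nlinarith [five_le_L κ]
  refine ⟨hS.1, hER, hS.2.1, h0.1, h0.2, fun ℓ h₁ h₂ => mem_lists_of_Icc (κ := κ) (le_trans hS.1 h₁) (h₂.trans (hER.trans hS.2.1))⟩

/-- The clamped widths are bounded by `WMC` on `[0, ℓtop]`, and dominate the true widths on `[ℓ₀, ℓtop]`; `8·WMC ≤ r⊥`. [folklore] -/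
theorem widths_at (a : Fin 2) : (∀ ℓ, ℓ ≤ ℓtop κ Φ p O a → WbC κ Φ p O a ℓ ≤ WMC κ Φ p O a) ∧
    (∀ ℓ, ℓ₀ κ Φ p O a ≤ ℓ → Skelφ.StepI.widths O.D.Gb O.D.Fb a ℓ (oth a) ≤ WbC κ Φ p O a ℓ) ∧
    8 * WMC κ Φ p O a ≤ (cells κ Φ p O).r (oth a) := by
  have h0 := (Mu_succ_le_ℓ₀_at hat a).2
  have hb := extents_le_at hat a
  refine ⟨fun ℓ hℓ => ?_, fun ℓ hℓ => ?_, ?_⟩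
  · unfold WbC WMC
    exact widths_oth_mono hat a (h0.trans (le_max_right _ _)) (max_le hℓ (hb.1.trans (hb.2.1.trans hb.2.2.1)))
  · unfold WbC; rw [max_eq_left hℓ]
  · unfold WMC
    have hk : O.D.k ≤ ℓtop κ Φ p O a := h0.trans (hb.1.trans (hb.2.1.trans hb.2.2.1))
    fin_cases a
    · simpa [oth] using spread_x_at hat hk le_rfl
    · simpa [oth] using spread_y_at hat hk le_rfl

end AtQ

end Sgn₂

end PlanarSkeletonSign

end Summit.CriticalPhenomena.PercolationContinuityZ3.Theorems.Transplant

end
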